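import Literature.Computability.AlgebraicComplexity.SymmetricDetRepresentationProofs
import Literature.Computability.AlgebraicComplexity.SymmDeterminantalComplexity
import Literature.Barriers.ValiantsHypothesis.GMT13SymmetricRepresentationsCharTwo
import Literature.NumberTheory.QuadraticForms.HasseMinkowskiDiagonal
import Literature.LinearAlgebra.Matrix.BlockDeterminantCommutingBlocks
import HarnessLib

/-!
# Quarez 2012: symmetric determinantal representation of polynomials — every polynomial of
# degree `d` in `n` variables is `det` of a SYMMETRIC affine pencil of size `2·C(n + ⌊d/2⌋, n)`

Source: R. Quarez, *Symmetric determinantal representation of polynomials*, Linear Algebra Appl.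
**436** (2012) 3642–3660, doi:10.1016/j.laa.2012.01.004 (= prépublication IRMAR / HAL 2008, the
`[Quarez08]` of GKKP 2011) [Quarez2012]; held text `paper:doi-10-1016-j-laa-2012-01-004`
(19 pp.; locators `p00NN:Lk` below refer to it). Topic `Literature/Computability/AlgebraicComplexity`
(the symmetric-determinantal-complexity dictionary: `HasSymmDetRepr`, `symmDeterminantalComplexity`
of `SymmDeterminantalComplexity.lean`; GKKP 2011 in `GKKP11SymmetricRepresentations.lean`).
Cell `val-lit`, seat t16 g8 (typer/prover; 0 named facts — everything below is PROVED).

## What the paper proves and what is typed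

Quarez gives "an elementary proof, only using linear algebra, of a result due to Helton,
McCullough and Vinnikov [HMV06, Thm. 14.1], which says that any polynomial can be written as the
determinant of a symmetric affine linear pencil" (abstract, p0002), with EXPLICIT size.
GKKP 2011 §4 (`paper:arxiv-1007.3804` p0016–p0017) compare their Thm. 7
(tree: `GKKP2011_thm7`, `4·C(n+d-1, n) - 2`) with it: "Quarez's construction is exponentially
better in the general case". The tree had GKKP's bound but not Quarez's; this file adds it.

| source item | Lean | status |
|---|---|---|
| §1 Notations (p0004): linear description `q = L(J - L_A(x))⁻¹C`, signature matrix, symmetric / unitary descriptions | prose of this docstring; `prop_2_6` hypotheses | — |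
| Def. 2.1 (p0004 L20) `S`-symmetrizable description; Prop. 2.2 (p0004 L27) symmetrization `S = UJUᵗ`; Rem. 2.3 | absorbed: the construction below is written directly in symmetrized ("folded") form | — |
| Prop. 2.4 (p0005 L21) Schur complement `det M = det D · det(A - BD⁻¹C)` | Mathlib `Matrix.det_fromBlocks₁₁` / `Matrix.det_fromBlocks₂₂` | cited |
| Def. 2.5 (p0006 L1) unipotent description; **Prop. 2.6** (p0006 L7) `1 - q = det(J) det(J - CCᵗ - L_A)` | `prop_2_6` | PROVED |
| §3.1 (p0007–8) the pencils `L_{A_k}`, `X_k` = all monomials of degree `k`, `m_{k,n} = C(n-1+k, n-1)` | `lett`, `hmon`, `hvec`, `root`, `parent`, `predN` (monomials of degree `≤ e` coded by `Sym (Option σ) e`), `card_nonRoot` | defs |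
| §3.2 **Prop. 3.2** (p0009 L104): a homogeneous `Q` of degree `2e+1` has an `S_N`-symmetrizable unipotent description of type `(L₀ S_N C₀)`, `N = 2·C(n+e, n)` (`λ = ½`) | `exists_split`, `pairE`, `exists_qform_eq` (dehomogenised: `q = X_eᵗ Φ X_e`, `Φ` symmetric affine) | PROVED |
| §3.3 **Thm. 3.4** (p0011 L79): over `ℝ`, `p(0) ≠ 0` ⇒ `p = p(0) det(J) det(J - L_A(x))`, `J` signature, `N = 2·C(n+⌊d/2⌋, n)` | `quarez2012_thm_3_4` | PROVED |
| §4 **Thm. 4.1 (1)** (p0014 L12): over a ring with `½`, `p = det(A₀ + L_A(x))`, symmetric, `N = 2·C(n+⌊d/2⌋, n)` | `quarez2012_thm_4_1` (+ `hasSymmDetRepr_of_totalDegree_le'` any finite variable set, `_field`, `hasSymmDetRepr_two_mul_choose_sub_one` size `N - 1`, `symmDeterminantalComplexity_le_two_mul_choose`, `exists_hasSymmDetRepr`) | PROVED |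
| §4 **Thm. 4.1 (2)** (p0014 L17): `p = P + p(0)`, `P` homogeneous of odd degree, `p(0) ∈ Rˣ` ⇒ signature form over `R` | `quarez2012_thm_4_1_2` (+ `exists_signature_form_of_isHomogeneous` any finite variable set; `swapCongr` = the `[[1,1],[1,-1]]`-trick of p0014) | PROVED |
| §4.1 Thm. 4.2 (p0017 L7): symmetric NC-polynomials | not typed (no non-commutative polynomial vocabulary in the tree) | — |
| §5 questions (unitary representations; Hankel-rank minimality) | not statements | — |
| GKKP 2011 §4 comparison with Thm. 7 | `two_mul_choose_le_gkkp_thm7_bound` | PROVED |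

## The proof (Quarez's, folded) and the one deviation

Quarez: (i) write the (homogenised, odd-degree) polynomial as a unipotent linear description
`Q = L₀(Id - L_B(x))⁻¹C₀` whose pencil `L_B = SD(L_{B_1}, …, L_{B_d})` is block-sub-diagonal and
PALINDROMIC, `L_{B_{d-i+1}} = L_{B_i}ᵗ`, the middle block `L_{B_{e+1}}` symmetric with
`Q = X_eᵗ L_{B_{e+1}} X_e` (Prop. 3.2; `X_e` = column of all monomials of degree `e`); (ii)
symmetrize with the anti-diagonal `S_N = ½WJWᵗ` (Prop. 2.2, p0014–p0015); (iii) read off the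
determinant by two Schur complements (Prop. 2.6); (iv) substitute `x_{n+1} = 1`. Here the same
objects are written down ALREADY FOLDED (dehomogenised from the start, the extra letter `none` of
`Sym (Option σ) e` playing `x_{n+1} = 1`): with `J'` = the non-root half-monomials
(monomials of degree `≤ e` other than `1`), `X' = (X_β)_{β ∈ J'}`, `N` the nilpotent matrix of the
recursion `X_β = x_{i(β)} X_{parent β}` (one half of the palindrome) and `Φ = [[Φ₀, φ], [φᵗ, Φ']]`
symmetric affine with `X_eᵗ Φ X_e = ±p` (the middle block), the matrix is
`bordered = [[Φ₀, (φ | -c)], [(φ | -c)ᵗ, [[Φ', (1+N)ᵗ], [1+N, 0]]]]` on `Unit ⊕ (J' ⊕ J')`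
— symmetric, affine, and by ONE Schur complement of the unipotent-cornered middle block
(`det_bordered`; `(1+N)⁻¹ = Σ (-N)^j`, tree `GKKP2011.geomInv` / `GKKP2011.IsLayered.det_one_add`
of `SymmetricDetRepresentationProofs.lean`) `det = (-1)^{|J'|} X_eᵗ Φ X_e = p`. Folding saves the
symmetrization matrices `W, P, Y` of p0014 and ONE row/column (the root monomial `1` is not
doubled): size `1 + 2(|J| - 1) = 2·C(n + e, n) - 1`; the printed `N = 2·C(n + ⌊d/2⌋, n)` follows by
padding (`HasSymmDetRepr.mono`). Everything else (the use of `½` in `Φ`, the monomial count by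
stars and bars `|Sym (Option σ) e| = C(|σ|+e, e)`, Schur complements) is as printed.

## Typed-vs-printed record

* "degree `d`" is typed "total degree `≤ d`" (monotone bound).
* **"over a ring `R` of characteristic different from `2`" (Thm. 4.1) is typed "`2` is a unit of
  `R`" (`[Invertible (2 : R)]`)** — the printed proof uses `½` (Prop. 3.2 `λ = ½`; p0015
  `W⁻¹ = ½JWᵗS_N`), and AS PRINTED the statement is false: over `R = ℤ` (characteristic `0 ≠ 2`)
  the degree-`2` polynomial `x₀x₁ + x₂` is the determinant of NO symmetric affine pencil of any
  size (`thm_4_1_asPrinted_counterexample_int`, by reduction mod `2` to Grenet–Monteil–Thomassé's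
  theorem, tree `GMT2013.not_hasSymmDetRepr_X_mul_X_add_X`). Over fields "characteristic `≠ 2`"
  and "`2` invertible" agree (`quarez2012_thm_4_1_field`).
* Thm. 3.4's "signature matrix `J` and symmetric linear pencil `L_A(x)`" is typed as ONE symmetric
  matrix `B = J - L_A(x)` of affine forms whose constant part `B.map constantCoeff` is `diag(ε)`,
  `εᵢ = ±1`; `p(0) = constantCoeff p`.

Honest framing: an UPPER bound / normal form for symmetric determinantal complexity (the
`sdc`-dictionary of routes SymPencil / LacunarySymmetroid); nothing here bears on lower bounds or
on `VP` versus `VNP`.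

## References

* R. Quarez, *Symmetric determinantal representation of polynomials*, Linear Algebra Appl. 436
  (2012) 3642–3660. [Quarez2012]
* B. Grenet, E. L. Kaltofen, P. Koiran, N. Portier, *Symmetric determinantal representation of
  weakly-skew circuits*, Contemp. Math. 556 (2011) = arXiv:1007.3804, §4. [GrenetEtAl2011]
* B. Grenet, T. Monteil, S. Thomassé, *Symmetric determinantal representations in characteristic
  2*, Linear Algebra Appl. 439 (2013) = arXiv:1210.5879, §4.2. [GrenetMonteilThomasse2013]
* J. W. Helton, S. A. McCullough, V. Vinnikov, *Noncommutative convexity arises from linear matrix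
  inequalities*, J. Funct. Anal. 240 (2006), Thm. 14.1 (the HMV theorem; cited by Quarez).
* J.-P. Serre, *A Course in Arithmetic*, Ch. IV §1.4 (orthogonal bases; tree
  `Literature.NumberTheory.QuadraticForms.exists_congr_diagonal`). [Serre1973]
-/

open Matrix MvPolynomial

noncomputable section

namespace Literature.Computability.AlgebraicComplexity

namespace Quarez2012

section Core

variable {R : Type*} [CommRing R] {J : Type*} [Fintype J] [DecidableEq J]

/-- The border row `(φ | -c)` of the bordered matrix: `φ β = Φ(root, β)` on the first copy of `J`,
`-c β` on the second copy. [cite: Quarez2012, Prop. 2.6 / §3.2 (the vectors `L₀`, `C₀`)] -/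
def borderRow (φ c : J → R) : Matrix Unit (J ⊕ J) R :=
  Matrix.of fun _ j => Sum.elim φ (-c) j

/-- The middle block `[[Φ', (1 + N)ᵀ], [1 + N, 0]]`: the symmetric part `Φ'` on the first copy and
the unipotent "predecessor" matrix `1 + N` coupling the two copies (Quarez's palindromic pencil
`L_B = SD(L_{B_1}, …, L_{B_d})` with `L_{B_{d-i+1}} = L_{B_i}ᵀ`, folded). [cite: Quarez2012, §3.2] -/
def midBlock' (Φ' N : Matrix J J R) : Matrix (J ⊕ J) (J ⊕ J) R :=
  Matrix.fromBlocks Φ' (1 + N)ᵀ (1 + N) 0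

/-- The bordered symmetric matrix on `Unit ⊕ (J ⊕ J)` (size `2|J| + 1`) attached to a corner
`Φ₀`, a row `φ`, a symmetric block `Φ'`, a (nilpotent) `N` and a vector `c`.
[cite: Quarez2012, Thm. 4.1 (proof)] -/
def bordered (Φ₀ : R) (φ : J → R) (Φ' N : Matrix J J R) (c : J → R) :
    Matrix (Unit ⊕ (J ⊕ J)) (Unit ⊕ (J ⊕ J)) R :=
  Matrix.fromBlocks (Matrix.of fun _ _ => Φ₀) (borderRow φ c) (borderRow φ c)ᵀ (midBlock' Φ' N)

omit [Fintype J] in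
/-- The middle block is symmetric when `Φ'` is. [cite: Quarez2012, Thm. 4.1 (1) (proof: `L_Ã` symmetric)] -/
theorem isSymm_midBlock' {Φ' : Matrix J J R} (hΦ' : Φ'.IsSymm) (N : Matrix J J R) :
    (midBlock' Φ' N).IsSymm := by
  unfold midBlock'
  exact Matrix.IsSymm.fromBlocks hΦ' rfl (by simp)

omit [Fintype J] in
/-- The bordered matrix is symmetric when `Φ'` is. [cite: Quarez2012, Thm. 4.1 (1) (proof)] -/
theorem isSymm_bordered (Φ₀ : R) (φ : J → R) {Φ' : Matrix J J R} (hΦ' : Φ'.IsSymm)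
    (N : Matrix J J R) (c : J → R) : (bordered Φ₀ φ Φ' N c).IsSymm := by
  unfold bordered
  refine Matrix.IsSymm.fromBlocks ?_ rfl (isSymm_midBlock' hΦ' N)
  exact Matrix.IsSymm.ext fun _ _ => rfl

/-- The explicit inverse `[[0, G], [Gᵀ, -Gᵀ Φ' G]]` of the middle block, `G = (1 + N)⁻¹`
(plumbing for the Schur complement). [cite: Quarez2012, Prop. 2.6 (proof)] -/
def midInv' (Φ' G : Matrix J J R) : Matrix (J ⊕ J) (J ⊕ J) R :=
  Matrix.fromBlocks 0 G Gᵀ (-(Gᵀ * Φ' * G))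

/-- `midBlock' Φ' N * midInv' Φ' G = 1` when `(1 + N) G = 1`. [folklore] -/
private theorem midBlock'_mul_midInv' (Φ' N G : Matrix J J R) (hG : (1 + N) * G = 1) :
    midBlock' Φ' N * midInv' Φ' G = 1 := by
  have hG' : G * (1 + N) = 1 := mul_eq_one_comm.1 hG
  have hT : (1 + N)ᵀ * Gᵀ = 1 := by
    rw [← transpose_mul, hG', transpose_one]
  unfold midBlock' midInv'
  rw [fromBlocks_multiply]
  simp only [Matrix.mul_zero, Matrix.zero_mul, zero_add, add_zero, Matrix.mul_neg, neg_zero,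
    ← Matrix.mul_assoc, hT, hG, Matrix.one_mul, add_neg_cancel, fromBlocks_one]

/-- `det (midBlock' Φ' N) = (-1)^|J|` when `1 + N` is invertible with determinant `1` (the
`det(J) = (-1)^{|J|}` of the folded signature, cf. `det(J - L_A(x)) = det(J)` in the proof of
Prop. 2.6). [cite: Quarez2012, Prop. 2.6 (proof)] -/
theorem det_midBlock' (Φ' N G : Matrix J J R) (hG : (1 + N) * G = 1) (hdet : (1 + N).det = 1) :
    (midBlock' Φ' N).det = (-1) ^ Fintype.card J := by
  have hG' : G * (1 + N) = 1 := mul_eq_one_comm.1 hG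
  have hfac : midBlock' Φ' N =
      Matrix.fromBlocks 1 ((Φ' - 1) * G) 0 1 * Matrix.fromBlocks 1 (1 + N)ᵀ (1 + N) 0 := by
    unfold midBlock'
    rw [fromBlocks_multiply]
    simp only [Matrix.one_mul, Matrix.mul_zero, add_zero, Matrix.zero_mul, zero_add,
      Matrix.mul_assoc, hG', Matrix.mul_one, add_sub_cancel]
  have hdetT : (1 + N)ᵀ.det = 1 := by rw [det_transpose, hdet]
  rw [hfac, det_mul, det_fromBlocks_zero₂₁, det_one, one_mul, one_mul, det_fromBlocks_one₁₁,
    zero_sub, ← neg_mul, det_mul, hdetT, mul_one, ← neg_one_smul R (1 + N), det_smul, hdet,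
    mul_one]

omit [DecidableEq J] in
/-- Entries of the congruence `B M Bᵀ` by the border row: `w · M w` with `w = (φ | -c)`.
[folklore] -/
private theorem borderRow_mul_mul_transpose_apply (φ c : J → R) (M : Matrix (J ⊕ J) (J ⊕ J) R)
    (u u' : Unit) :
    (borderRow φ c * M * (borderRow φ c)ᵀ) u u' = Sum.elim φ (-c) ⬝ᵥ (M *ᵥ Sum.elim φ (-c)) := by
  simp only [Matrix.mul_apply, Matrix.transpose_apply, borderRow, Matrix.of_apply, dotProduct,
    Matrix.mulVec, Finset.sum_mul, Finset.mul_sum]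
  rw [Finset.sum_comm]
  exact Finset.sum_congr rfl fun x _ => Finset.sum_congr rfl fun y _ => by ring

omit [DecidableEq J] in
/-- `w · [[0, G], [Gᵀ, -GᵀΦ'G]] w = -2 φ·(G c) - (G c)·Φ'(G c)` for `w = (φ | -c)`. [folklore] -/
private theorem dotProduct_midInv'_mulVec (φ c : J → R) (Φ' G : Matrix J J R) :
    Sum.elim φ (-c) ⬝ᵥ (midInv' Φ' G *ᵥ Sum.elim φ (-c)) =
      -(2 * (φ ⬝ᵥ (G *ᵥ c))) - (G *ᵥ c) ⬝ᵥ (Φ' *ᵥ (G *ᵥ c)) := by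
  have h1 : c ⬝ᵥ (Gᵀ *ᵥ φ) = φ ⬝ᵥ (G *ᵥ c) := by
    rw [Matrix.mulVec_transpose, dotProduct_comm, ← Matrix.dotProduct_mulVec]
  have h2 : c ⬝ᵥ ((Gᵀ * Φ' * G) *ᵥ c) = (G *ᵥ c) ⬝ᵥ (Φ' *ᵥ (G *ᵥ c)) := by
    rw [← Matrix.mulVec_mulVec, ← Matrix.mulVec_mulVec, Matrix.mulVec_transpose, dotProduct_comm,
      ← Matrix.dotProduct_mulVec, dotProduct_comm]
  unfold midInv'
  simp only [Matrix.fromBlocks_mulVec, Sum.elim_comp_inl, Sum.elim_comp_inr,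
    sumElim_dotProduct_sumElim, Matrix.zero_mulVec, zero_add, Matrix.mulVec_neg,
    Matrix.neg_mulVec, neg_neg, dotProduct_neg, neg_dotProduct, dotProduct_add, h1, h2]
  ring

omit [DecidableEq J] in
/-- The Schur complement of the middle block in the bordered matrix:
`Φ₀ - (φ | -c) · [[0, G], [Gᵀ, -GᵀΦ'G]] · (φ | -c)ᵀ = Φ₀ + 2 φ·x + xᵀ Φ' x` with `x = G c`.
[cite: Quarez2012, Prop. 2.6 (proof)] -/
theorem schur_bordered (Φ₀ : R) (φ : J → R) (Φ' G : Matrix J J R) (c : J → R) :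
    (Matrix.of fun (_ : Unit) (_ : Unit) => Φ₀) - borderRow φ c * midInv' Φ' G * (borderRow φ c)ᵀ =
      Matrix.of fun _ _ => Φ₀ + 2 * (φ ⬝ᵥ (G *ᵥ c)) + (G *ᵥ c) ⬝ᵥ (Φ' *ᵥ (G *ᵥ c)) := by
  ext u u'
  rw [Matrix.sub_apply, borderRow_mul_mul_transpose_apply, dotProduct_midInv'_mulVec,
    Matrix.of_apply, Matrix.of_apply]
  ring

/-- **Determinant of the bordered matrix.** If `(1 + N) G = 1`, `det (1 + N) = 1` and
`(1 + N) x = c`, then `det (bordered Φ₀ φ Φ' N c) = (-1)^|J| · (Φ₀ + 2 φ·x + xᵀ Φ' x)`.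
[cite: Quarez2012, Prop. 2.6 / Thm. 4.1 (proof)] -/
theorem det_bordered (Φ₀ : R) (φ : J → R) (Φ' N G : Matrix J J R) (c x : J → R)
    (hG : (1 + N) * G = 1) (hdet : (1 + N).det = 1) (hx : (1 + N) *ᵥ x = c) :
    (bordered Φ₀ φ Φ' N c).det =
      (-1) ^ Fintype.card J * (Φ₀ + 2 * (φ ⬝ᵥ x) + x ⬝ᵥ (Φ' *ᵥ x)) := by
  letI : Invertible (midBlock' Φ' N) :=
    invertibleOfRightInverse _ _ (midBlock'_mul_midInv' Φ' N G hG)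
  have hinv : ⅟(midBlock' Φ' N) = midInv' Φ' G :=
    invOf_eq_right_inv (midBlock'_mul_midInv' Φ' N G hG)
  have hGc : G *ᵥ c = x := by
    rw [← hx, Matrix.mulVec_mulVec, mul_eq_one_comm.1 hG, Matrix.one_mulVec]
  unfold bordered
  rw [det_fromBlocks₂₂, hinv, det_midBlock' Φ' N G hG hdet, schur_bordered, det_unique,
    Matrix.of_apply, hGc]

end Core

/-! ### Half-monomials: the index set `Sym (Option σ) e` -/

section Monomials

variable (R : Type*) [CommRing R] (σ : Type*)

/-- Value of a letter: the extra letter `none` (Quarez's homogenising variable `x_{n+1}`, set to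
`1`) and the variables `some i ↦ xᵢ`. [cite: Quarez2012, §3.3 (substitution `x_{n+1} = 1`)] -/
def lett : Option σ → MvPolynomial σ R := fun o => o.elim 1 X

/-- The monomial of degree `≤ e` coded by a multiset of `e` letters (`none` = padding):
the column `X_e` of all monomials of degree `≤ e` (Quarez's `X_k = L_{A_k} ⋯ L_{A_1}`, §3.1,
dehomogenised). [cite: Quarez2012, §3.1] -/
def hmon {e : ℕ} (s : Sym (Option σ) e) : MvPolynomial σ R :=
  ((s : Multiset (Option σ)).map (lett R σ)).prod

/-- The root half-monomial `1 = x_{n+1}^e`. [cite: Quarez2012, §3.2 (`C₀ = (1, 0, …, 0)ᵗ`)] -/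
def root (e : ℕ) : Sym (Option σ) e := Sym.replicate e none

variable {R σ}

/-- The padding letter is `1`. [folklore] -/
@[simp] private theorem lett_none : lett R σ none = 1 := rfl

/-- A variable letter is the variable. [folklore] -/
@[simp] private theorem lett_some (i : σ) : lett R σ (some i) = X i := rfl

/-- Letters are affine. [folklore] -/
private theorem totalDegree_lett_le (o : Option σ) : (lett R σ o).totalDegree ≤ 1 := by
  cases o with
  | none => simp
  | some i =>
    refine (totalDegree_monomial_le (Finsupp.single i 1) (1 : R)).trans ?_
    simp

/-- The root codes the monomial `1`. [folklore] -/
@[simp] private theorem hmon_root (e : ℕ) : hmon R σ (root σ e) = 1 := by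
  simp [hmon, root, Sym.coe_replicate, Multiset.map_replicate]

/-- A non-root half-monomial contains a variable. [folklore] -/
private theorem exists_some_mem {e : ℕ} {s : Sym (Option σ) e} (hs : s ≠ root σ e) :
    ∃ i : σ, some i ∈ s := by
  by_contra h
  apply hs
  refine (Sym.eq_replicate_iff).2 fun b hb => ?_
  cases b with
  | none => rfl
  | some i => exact absurd ⟨i, hb⟩ h

/-- The non-root half-monomials (monomials of degree `≤ e` other than `1`; index set of the two
off-corner blocks). [cite: Quarez2012, §3.1] -/
abbrev NonRoot (σ : Type*) (e : ℕ) := {s : Sym (Option σ) e // s ≠ root σ e}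

variable {e : ℕ}

/-- A variable occurring in a non-root half-monomial (any choice works). [folklore] -/
def var (β : NonRoot σ e) : σ := Classical.choose (exists_some_mem β.2)

/-- The chosen variable occurs. [folklore] -/
private theorem some_var_mem (β : NonRoot σ e) : some (var β) ∈ (β.1 : Multiset (Option σ)) :=
  Sym.mem_coe.2 (Classical.choose_spec (exists_some_mem β.2))

variable [DecidableEq σ]

/-- Layers are `≤ e`. [folklore] -/
private theorem count_none_le (s : Sym (Option σ) e) : (s : Multiset (Option σ)).count none ≤ e := by
  simpa using Multiset.count_le_card none (s : Multiset (Option σ))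

/-- The predecessor of a non-root half-monomial: remove one occurrence of the chosen variable and
pad with the extra letter (one edge of the tree of monomials along which Quarez's pencils
`L_{A_k}` multiply by a variable). [cite: Quarez2012, §3.1] -/
def parent (β : NonRoot σ e) : Sym (Option σ) e :=
  ⟨none ::ₘ (β.1 : Multiset (Option σ)).erase (some (var β)), by
    rw [Multiset.card_cons, Multiset.card_erase_add_one (some_var_mem β), Sym.card_coe]⟩

/-- Unfolding of `parent`. [folklore] -/
private theorem coe_parent (β : NonRoot σ e) :
    (parent β : Multiset (Option σ)) = none ::ₘ (β.1 : Multiset (Option σ)).erase (some (var β)) :=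
  rfl

/-- `X_β = x_{i(β)} · X_{parent β}`. [cite: Quarez2012, §3.1] -/
theorem hmon_eq_X_mul_parent (β : NonRoot σ e) :
    hmon R σ β.1 = X (var β) * hmon R σ (parent β) := by
  unfold hmon
  rw [coe_parent, Multiset.map_cons, Multiset.prod_cons, lett_none, one_mul,
    ← Multiset.prod_map_erase (some_var_mem β), lett_some]

/-- The layer (number of padding letters) goes up by one along the predecessor map. [folklore] -/
private theorem count_none_parent (β : NonRoot σ e) :
    (parent β : Multiset (Option σ)).count none = (β.1 : Multiset (Option σ)).count none + 1 := by
  rw [coe_parent, Multiset.count_cons_self, Multiset.count_erase_of_ne (by simp)]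

variable (R)

/-- The nilpotent predecessor matrix `N β α = -x_{i(β)} [α = parent β]` on the non-root
half-monomials (the strictly block-sub-diagonal part of Quarez's `L_B(x)`).
[cite: Quarez2012, §3.2] -/
def predN (σ : Type*) [DecidableEq σ] (e : ℕ) :
    Matrix (NonRoot σ e) (NonRoot σ e) (MvPolynomial σ R) :=
  Matrix.of fun β α => if α.1 = parent β then -X (var β) else 0

/-- The border vector `c β = x_{i(β)} [parent β = root]` (children of the root). [folklore] -/
def rootCol (σ : Type*) [DecidableEq σ] (e : ℕ) : NonRoot σ e → MvPolynomial σ R :=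
  fun β => if parent β = root σ e then X (var β) else 0

/-- The vector of non-root half-monomials. [cite: Quarez2012, §3.1] -/
def hvec' (σ : Type*) [DecidableEq σ] (e : ℕ) : NonRoot σ e → MvPolynomial σ R :=
  fun β => hmon R σ β.1

variable {R}

/-- `N` is layered by the number of padding letters (tree `GKKP2011.IsLayered`): an edge
`β → parent β` raises the layer by one. [folklore] -/
private theorem predN_isLayered :
    GKKP2011.IsLayered (predN R σ e) (fun β => (β.1 : Multiset (Option σ)).count none) := by
  intro β α h
  simp only [predN, Matrix.of_apply, ne_eq, ite_eq_right_iff, neg_eq_zero, Classical.not_imp]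
    at h
  dsimp only
  rw [h.1, count_none_parent]

variable [Fintype σ]

/-- Hence `N^{e+1} = 0`. [folklore] -/
private theorem predN_pow_eq_zero : predN R σ e ^ (e + 1) = 0 :=
  predN_isLayered.pow_eq_zero fun β => count_none_le β.1

/-- and `det (1 + N) = 1` ("`L_B` is nilpotent", Quarez §3.2 condition 2)). [cite: Quarez2012, §3.2] -/
theorem det_one_add_predN : (1 + predN R σ e).det = 1 :=
  predN_isLayered.det_one_add

/-- and `(1 + N) · Σ_{j ≤ e} (-N)^j = 1` (the entries of `(Id - L_B(x))⁻¹` are polynomial).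
[cite: Quarez2012, §3.1] -/
theorem one_add_predN_mul_geomInv :
    (1 + predN R σ e) * GKKP2011.geomInv (predN R σ e) (e + 1) = 1 :=
  GKKP2011.one_add_mul_geomInv predN_pow_eq_zero

/-- `(1 + N) X' = c`: the defining recursion `X_β - x_{i(β)} X_{parent β} = 0` of the monomials,
with the root monomial `1` moved to the right-hand side. [cite: Quarez2012, §3.1] -/
theorem one_add_predN_mulVec_hvec' :
    (1 + predN R σ e) *ᵥ hvec' R σ e = rootCol R σ e := by
  ext β
  rw [Matrix.add_mulVec, Matrix.one_mulVec, Pi.add_apply, Matrix.mulVec, dotProduct]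
  simp only [predN, hvec', rootCol, Matrix.of_apply, ite_mul, zero_mul, neg_mul]
  by_cases hroot : parent β = root σ e
  · rw [if_pos hroot, Finset.sum_eq_zero, add_zero, hmon_eq_X_mul_parent, hroot, hmon_root,
      mul_one]
    intro α _
    rw [if_neg]
    intro hα
    exact α.2 (hα.trans hroot)
  · rw [if_neg hroot, Finset.sum_eq_single ⟨parent β, hroot⟩]
    · rw [if_pos rfl, hmon_eq_X_mul_parent, add_neg_cancel]
    · intro α _ hα
      rw [if_neg]
      intro h
      exact hα (Subtype.ext h)
    · intro h
      exact absurd (Finset.mem_univ _) h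

end Monomials

/-! ### The quadratic form `X_eᵀ Φ X_e` and its realisation of every polynomial of degree `≤ 2e+1` -/

section QuadraticForm

variable {R : Type*} [CommRing R] {σ : Type*} {e : ℕ}

variable (R σ e) in
/-- The vector `X_e` of all half-monomials (degree `≤ e`). [cite: Quarez2012, §3.1] -/
def hvec : Sym (Option σ) e → MvPolynomial σ R := fun s => hmon R σ s

/-- Unfolding of `hvec`. [folklore] -/
@[simp] private theorem hvec_apply (s : Sym (Option σ) e) : hvec R σ e s = hmon R σ s := rfl

/-- **Splitting a monomial of degree `≤ 2e+1`** as `X_α · X_β · ℓ` with two half-monomials and a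
letter `ℓ ∈ {1, x₁, …, xₙ}` (the entries `φ_{α,β} = Σᵢ λ^{(i)}_{α,β} b_{α+β+δ(i)} xᵢ` of Quarez's
middle pencil `L_{B_{e+1}}`). [cite: Quarez2012, Prop. 3.2 (proof)] -/
theorem exists_split (γ : σ →₀ ℕ) (hγ : (γ.sum fun _ k => k) ≤ 2 * e + 1) :
    ∃ t : Sym (Option σ) e × Sym (Option σ) e × Option σ,
      hmon R σ t.1 * hmon R σ t.2.1 * lett R σ t.2.2 = monomial γ 1 ∧
        ((2 * e + 1 ≤ γ.sum fun _ k => k) → t.2.2 ≠ none) := by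
  classical
  -- the padded multiset of letters of the monomial, of size exactly `2e + 1`
  set m : Multiset (Option σ) :=
    (Finsupp.toMultiset γ).map some + Multiset.replicate (2 * e + 1 - γ.sum fun _ k => k) none
    with hm
  have hdeg : (γ.sum fun _ => id) = γ.sum fun _ k => k := rfl
  have hcard : Multiset.card m = 2 * e + 1 := by
    rw [hm, Multiset.card_add, Multiset.card_map, Finsupp.card_toMultiset, hdeg,
      Multiset.card_replicate]
    omega
  have hprod : (m.map (lett R σ)).prod = monomial γ 1 := by
    rw [hm, Multiset.map_add, Multiset.prod_add, Multiset.map_replicate, lett_none,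
      Multiset.prod_replicate, one_pow, mul_one, Multiset.map_map,
      show lett R σ ∘ some = X from funext fun i => rfl, Finsupp.toMultiset_map,
      Finsupp.prod_toMultiset, Finsupp.prod_mapDomain_index (fun _ => pow_zero _)
        (fun _ _ _ => pow_add _ _ _), monomial_eq, C_1, one_mul]
  -- cut a listing of `m` into pieces of lengths `e`, `e`, `1`
  set l := m.toList with hl
  have hlm : (l : Multiset (Option σ)) = m := Multiset.coe_toList m
  have hlen : l.length = 2 * e + 1 := by rw [← Multiset.coe_card, hlm, hcard]
  have hr : ((l.drop e).drop e).length = 1 := by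
    simp only [List.length_drop, hlen]
    omega
  obtain ⟨z, hz⟩ := List.length_eq_one_iff.1 hr
  have ha : Multiset.card ((l.take e : List (Option σ)) : Multiset (Option σ)) = e := by
    simp only [Multiset.coe_card, List.length_take, hlen]
    omega
  have hb : Multiset.card (((l.drop e).take e : List (Option σ)) : Multiset (Option σ)) = e := by
    simp only [Multiset.coe_card, List.length_take, List.length_drop, hlen]
    omega
  have hsplit : m = ((l.take e : List (Option σ)) : Multiset (Option σ)) +
      (((l.drop e).take e : List (Option σ)) : Multiset (Option σ)) + {z} := by
    rw [← hlm, Multiset.coe_add, ← Multiset.coe_singleton, Multiset.coe_add, ← hz,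
      List.append_assoc, List.take_append_drop, List.take_append_drop]
  refine ⟨(⟨_, ha⟩, ⟨_, hb⟩, z), ?_, fun hge => ?_⟩
  · rw [← hprod, hsplit, Multiset.map_add, Multiset.map_add, Multiset.prod_add, Multiset.prod_add,
      Multiset.map_singleton, Multiset.prod_singleton]
    rfl
  · -- no padding letters when the degree is exactly `2e + 1`
    have hzm : z ∈ m := by
      rw [hsplit]
      exact Multiset.mem_add.2 (Or.inr (Multiset.mem_singleton_self z))
    rw [hm, show (2 * e + 1 - γ.sum fun _ k => k) = 0 by omega, Multiset.replicate_zero, add_zero,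
      Multiset.mem_map] at hzm
    obtain ⟨i, -, rfl⟩ := hzm
    exact Option.some_ne_none i

variable [DecidableEq σ]

/-- A chosen splitting of every exponent vector (junk outside degree `≤ 2e+1`). [folklore] -/
def split (R : Type*) [CommRing R] (σ : Type*) [DecidableEq σ] (e : ℕ) (γ : σ →₀ ℕ) :
    Sym (Option σ) e × Sym (Option σ) e × Option σ :=
  if γ = 0 then (root σ e, root σ e, none)
  else if h : (γ.sum fun _ k => k) ≤ 2 * e + 1 then Classical.choose (exists_split (R := R) γ h)
  else (root σ e, root σ e, none)

/-- The constant monomial is split at the root. [folklore] -/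
private theorem split_zero : split R σ e 0 = (root σ e, root σ e, none) := by
  rw [split, if_pos rfl]

/-- A monomial of degree exactly `2e + 1` is split with a variable letter. [folklore] -/
private theorem split_ne_none {γ : σ →₀ ℕ} (hγ0 : γ ≠ 0) (hγ : (γ.sum fun _ k => k) = 2 * e + 1) :
    (split R σ e γ).2.2 ≠ none := by
  rw [split, if_neg hγ0, dif_pos hγ.le]
  exact (Classical.choose_spec (exists_split (R := R) γ hγ.le)).2 hγ.ge

/-- The chosen splitting splits. [folklore] -/
private theorem split_spec {γ : σ →₀ ℕ} (hγ : (γ.sum fun _ k => k) ≤ 2 * e + 1) :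
    hmon R σ (split R σ e γ).1 * hmon R σ (split R σ e γ).2.1 * lett R σ (split R σ e γ).2.2 =
      monomial γ 1 := by
  by_cases hγ0 : γ = 0
  · subst hγ0
    rw [split_zero, hmon_root, lett_none, mul_one, mul_one, ← C_apply, C_1]
  · rw [split, if_neg hγ0, dif_pos hγ]
    exact (Classical.choose_spec (exists_split (R := R) γ hγ)).1

variable [Invertible (2 : R)]

variable (R σ e) in
/-- The symmetric elementary matrix `½ ℓ (E_{αβ} + E_{βα})` realising the monomial `x^γ` as
`X_eᵀ Φ X_e` (Quarez's choice `λ^{(i)}_{α₀β₀} = λ^{(i)}_{β₀α₀} = ½`, resp. `1` on the diagonal).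
[cite: Quarez2012, Prop. 3.2 (proof, (ii))] -/
def pairE (γ : σ →₀ ℕ) : Matrix (Sym (Option σ) e) (Sym (Option σ) e) (MvPolynomial σ R) :=
  Matrix.single (split R σ e γ).1 (split R σ e γ).2.1 (C (⅟2 : R) * lett R σ (split R σ e γ).2.2) +
    Matrix.single (split R σ e γ).2.1 (split R σ e γ).1 (C (⅟2 : R) * lett R σ (split R σ e γ).2.2)

/-- The elementary matrix is symmetric. [folklore] -/
private theorem pairE_isSymm (γ : σ →₀ ℕ) : (pairE R σ e γ).IsSymm := by
  unfold pairE Matrix.IsSymm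
  rw [transpose_add, transpose_single, transpose_single, add_comm]

/-- The elementary matrix has affine entries (`0`, `½ℓ`, `ℓ`). [folklore] -/
private theorem totalDegree_pairE_le (γ : σ →₀ ℕ) (a b : Sym (Option σ) e) :
    (pairE R σ e γ a b).totalDegree ≤ 1 := by
  have hw : ∀ z : Option σ, (C (⅟2 : R) * lett R σ z).totalDegree ≤ 1 := fun z =>
    (totalDegree_mul _ _).trans (by simpa using totalDegree_lett_le z)
  unfold pairE
  rw [Matrix.add_apply, Matrix.single_apply, Matrix.single_apply]
  refine (totalDegree_add _ _).trans (max_le ?_ ?_) <;> split_ifs <;> simp [hw]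

variable [Fintype σ]

/-- `X_eᵀ (½ℓ(E_{αβ} + E_{βα})) X_e = X_α X_β ℓ = x^γ`. [cite: Quarez2012, Prop. 3.2 (proof)] -/
theorem qform_pairE {γ : σ →₀ ℕ} (hγ : (γ.sum fun _ k => k) ≤ 2 * e + 1) :
    hvec R σ e ⬝ᵥ (pairE R σ e γ *ᵥ hvec R σ e) = monomial γ 1 := by
  have key := split_spec (R := R) (σ := σ) (e := e) hγ
  have h2 : (2 : MvPolynomial σ R) * C (⅟2 : R) = 1 := by
    rw [← map_ofNat (C : R →+* MvPolynomial σ R) 2, ← map_mul, mul_invOf_self, map_one]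
  unfold pairE
  rw [Matrix.add_mulVec, dotProduct_add, Matrix.single_mulVec_eq, Matrix.single_mulVec_eq,
    dotProduct_smul, dotProduct_smul, dotProduct_single, dotProduct_single, smul_eq_mul,
    smul_eq_mul]
  simp only [hvec_apply]
  linear_combination
    (hmon R σ (split R σ e γ).1 * hmon R σ (split R σ e γ).2.1 * lett R σ (split R σ e γ).2.2) * h2 +
      key

/-- **Every polynomial of degree `≤ 2e+1` is a quadratic form `X_eᵀ Φ X_e` in the half-monomials
with a symmetric matrix `Φ` of affine linear forms** (Quarez's symmetrizable unipotent linear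
description, Prop. 3.2, dehomogenised; `½ ∈ R` is used here).
[cite: Quarez2012, Prop. 3.2] -/
theorem exists_qform_eq (q : MvPolynomial σ R) (hq : q.totalDegree ≤ 2 * e + 1) :
    ∃ Φ : Matrix (Sym (Option σ) e) (Sym (Option σ) e) (MvPolynomial σ R),
      Φ.IsSymm ∧ (∀ a b, (Φ a b).totalDegree ≤ 1) ∧ hvec R σ e ⬝ᵥ (Φ *ᵥ hvec R σ e) = q := by
  -- by induction over the support, one symmetric elementary matrix per monomial
  have key : ∀ s : Finset (σ →₀ ℕ), (∀ γ ∈ s, (γ.sum fun _ k => k) ≤ 2 * e + 1) →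
      ∃ Φ : Matrix (Sym (Option σ) e) (Sym (Option σ) e) (MvPolynomial σ R),
        Φ.IsSymm ∧ (∀ a b, (Φ a b).totalDegree ≤ 1) ∧
          hvec R σ e ⬝ᵥ (Φ *ᵥ hvec R σ e) = ∑ γ ∈ s, monomial γ (q.coeff γ) := by
    intro s
    induction s using Finset.induction_on with
    | empty =>
      intro _
      exact ⟨0, Matrix.isSymm_zero, fun a b => by simp, by simp⟩
    | insert γ s hγs ih =>
      intro hs
      obtain ⟨Φ, hΦs, hΦd, hΦq⟩ := ih fun γ' hγ' => hs γ' (Finset.mem_insert_of_mem hγ')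
      refine ⟨q.coeff γ • pairE R σ e γ + Φ, (Matrix.IsSymm.smul (pairE_isSymm γ) _).add hΦs,
        fun a b => ?_, ?_⟩
      · rw [Matrix.add_apply, Matrix.smul_apply]
        exact (totalDegree_add _ _).trans
          (max_le ((totalDegree_smul_le _ _).trans (totalDegree_pairE_le γ a b)) (hΦd a b))
      · rw [Matrix.add_mulVec, dotProduct_add, Matrix.smul_mulVec, dotProduct_smul, hΦq,
          qform_pairE (hs γ (Finset.mem_insert_self γ s)), smul_monomial, smul_eq_mul, mul_one,
          Finset.sum_insert hγs]
  obtain ⟨Φ, h1, h2, h3⟩ := key q.support fun γ hγ => (le_totalDegree hγ).trans hq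
  exact ⟨Φ, h1, h2, h3.trans q.as_sum.symm⟩

end QuadraticForm

/-! ### Assembly: the symmetric representation of size `2·C(n+e, n) - 1` -/

section Assembly

variable {R : Type*} [CommRing R] {σ : Type*} [DecidableEq σ] [Fintype σ] {e : ℕ}

/-- Splitting the quadratic form at the root: `X_eᵀ Φ X_e = Φ₀ + 2 φ·X' + X'ᵀ Φ' X'` where
`X_e = (1 | X')`, `Φ = [[Φ₀, φ], [φᵀ, Φ']]` (Quarez's `Q(x) = (X_e)ᵗ L_{B_{e+1}} (X_e)` read after
the substitution `x_{n+1} = 1`). [cite: Quarez2012, Prop. 3.2 (proof) / §3.3 (substitution `x_{n+1} = 1`)] -/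
theorem qform_eq_root_add (Φ : Matrix (Sym (Option σ) e) (Sym (Option σ) e) (MvPolynomial σ R))
    (hΦ : Φ.IsSymm) :
    hvec R σ e ⬝ᵥ (Φ *ᵥ hvec R σ e) =
      Φ (root σ e) (root σ e) + 2 * ((fun β : NonRoot σ e => Φ (root σ e) β.1) ⬝ᵥ hvec' R σ e) +
        hvec' R σ e ⬝ᵥ (Φ.submatrix Subtype.val Subtype.val *ᵥ hvec' R σ e) := by
  have inner : ∀ a, (Φ *ᵥ hvec R σ e) a =
      Φ a (root σ e) + ∑ β : NonRoot σ e, Φ a β.1 * hmon R σ β.1 := by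
    intro a
    rw [Matrix.mulVec, dotProduct, Fintype.sum_eq_add_sum_subtype_ne _ (root σ e), hvec_apply,
      hmon_root, mul_one]
    rfl
  rw [dotProduct, Fintype.sum_eq_add_sum_subtype_ne _ (root σ e)]
  simp only [inner, hvec_apply, hmon_root, one_mul]
  simp only [dotProduct, hvec', Matrix.mulVec, Matrix.submatrix_apply, mul_add,
    Finset.sum_add_distrib]
  have hsym : ∑ β : NonRoot σ e, hmon R σ β.1 * Φ β.1 (root σ e) =
      ∑ β : NonRoot σ e, Φ (root σ e) β.1 * hmon R σ β.1 :=
    Finset.sum_congr rfl fun β _ => by rw [hΦ.apply β.1 (root σ e), mul_comm]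
  rw [hsym]
  ring

variable [Invertible (2 : R)]

/-- **The bordered matrix realises `p`**: for `p` of total degree `≤ 2e + 1` there is a symmetric
matrix of affine linear forms on `Unit ⊕ (J' ⊕ J')` (`J'` = non-root half-monomials) with
determinant `p`. [cite: Quarez2012, Thm. 4.1 (1)] -/
theorem exists_bordered_det_eq (p : MvPolynomial σ R) (hp : p.totalDegree ≤ 2 * e + 1) :
    ∃ M : Matrix (Unit ⊕ (NonRoot σ e ⊕ NonRoot σ e)) (Unit ⊕ (NonRoot σ e ⊕ NonRoot σ e))
      (MvPolynomial σ R), M.IsSymm ∧ (∀ a b, (M a b).totalDegree ≤ 1) ∧ M.det = p := by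
  set sgn : R := (-1) ^ Fintype.card (NonRoot σ e) with hsgn
  obtain ⟨Φ, hΦs, hΦd, hΦq⟩ :=
    exists_qform_eq (e := e) (sgn • p) ((totalDegree_smul_le _ _).trans hp)
  refine ⟨bordered (Φ (root σ e) (root σ e)) (fun β => Φ (root σ e) β.1)
      (Φ.submatrix Subtype.val Subtype.val) (predN R σ e) (rootCol R σ e),
    isSymm_bordered _ _ (hΦs.submatrix _) _ _, ?_, ?_⟩
  · -- affine entries
    have h1N : ∀ a b : NonRoot σ e, ((1 + predN R σ e) a b).totalDegree ≤ 1 := by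
      intro a b
      rw [Matrix.add_apply, Matrix.one_apply, predN, Matrix.of_apply]
      refine (totalDegree_add _ _).trans (max_le ?_ ?_) <;> split_ifs <;>
        simp [totalDegree_neg, (totalDegree_lett_le (R := R) (some (var a))).trans']
    have hc : ∀ b : NonRoot σ e, (rootCol R σ e b).totalDegree ≤ 1 := by
      intro b
      rw [rootCol]
      split_ifs
      · exact totalDegree_lett_le (R := R) (some (var b))
      · simp
    rintro (u | a | a) (u' | b | b)
    · exact hΦd _ _
    · exact hΦd _ _
    · simpa [bordered, borderRow, totalDegree_neg] using hc b
    · exact hΦd _ _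
    · exact hΦd _ _
    · change (((1 + predN R σ e)ᵀ) a b).totalDegree ≤ 1
      rw [transpose_apply]
      exact h1N b a
    · simpa [bordered, borderRow, totalDegree_neg] using hc a
    · simpa [bordered, midBlock'] using h1N a b
    · simp [bordered, midBlock']
  · -- determinant
    rw [det_bordered _ _ _ _ (GKKP2011.geomInv (predN R σ e) (e + 1)) _ (hvec' R σ e)
      one_add_predN_mul_geomInv det_one_add_predN one_add_predN_mulVec_hvec',
      ← qform_eq_root_add Φ hΦs, hΦq, hsgn, smul_eq_C_mul, map_pow, map_neg, map_one,
      ← mul_assoc, ← pow_add, ← two_mul, pow_mul, neg_one_sq, one_pow, one_mul]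

omit [DecidableEq σ] [Fintype σ] [Invertible (2 : R)] in
/-- Reindexing along `Fintype.equivFin`: a symmetric matrix of affine forms with determinant `p`
on any finite index type `ι` is a symmetric determinantal representation of size `|ι|` in the
sense of the tree's `HasSymmDetRepr` (`Fin m`-indexed, GKKP 2011 §1.1). [cite: GrenetEtAl2011, §1.1] -/
theorem hasSymmDetRepr_of_matrix {ι : Type*} [Fintype ι] [DecidableEq ι] {p : MvPolynomial σ R}
    (M : Matrix ι ι (MvPolynomial σ R)) (hs : M.IsSymm) (hd : ∀ a b, (M a b).totalDegree ≤ 1)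
    (hdet : M.det = p) : HasSymmDetRepr p (Fintype.card ι) := by
  refine ⟨Matrix.reindex (Fintype.equivFin ι) (Fintype.equivFin ι) M, hs.submatrix _,
    fun i j => ?_, ?_⟩
  · simpa only [Matrix.reindex_apply, Matrix.submatrix_apply] using hd _ _
  · rw [Matrix.det_reindex_self, hdet]

omit [Invertible (2 : R)] in
/-- `|J'| = C(n + e, e) - 1`: the half-monomials of degree `≤ e` in `n` variables are
`C(n+e, e)` in number (stars and bars, `Sym.card_sym_eq_choose`). [cite: Quarez2012, §3.1
(`m_k = C(n-1+k, n-1)`, `N = 2 Σ_{k ≤ e} m_k = 2·C(n+e, n)`)] -/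
theorem card_nonRoot : Fintype.card (NonRoot σ e) = (Fintype.card σ + e).choose e - 1 := by
  rw [Fintype.card_subtype_compl, Fintype.card_subtype_eq, Sym.card_sym_eq_choose,
    Fintype.card_option, Nat.add_right_comm, Nat.add_sub_cancel]

/-- **Quarez 2012, Thm. 4.1 (1), sharpened by one: degree `≤ 2e + 1` in `|σ|` variables ⇒ a
symmetric affine determinantal representation of size `2·C(|σ|+e, e) - 1`.**
[cite: Quarez2012, Thm. 4.1 (1)] -/
theorem hasSymmDetRepr_of_totalDegree_le (p : MvPolynomial σ R) (hp : p.totalDegree ≤ 2 * e + 1) :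
    HasSymmDetRepr p (2 * (Fintype.card σ + e).choose e - 1) := by
  obtain ⟨M, hs, hd, hdet⟩ := exists_bordered_det_eq p hp
  have h := hasSymmDetRepr_of_matrix M hs hd hdet
  have hpos : 1 ≤ (Fintype.card σ + e).choose e := Nat.choose_pos (Nat.le_add_left e _)
  have hcard : Fintype.card (Unit ⊕ (NonRoot σ e ⊕ NonRoot σ e)) =
      2 * (Fintype.card σ + e).choose e - 1 := by
    rw [Fintype.card_sum, Fintype.card_sum, Fintype.card_unit, card_nonRoot]
    omega
  rwa [hcard] at h

end Assembly

/-! ### Quarez's Proposition 2.6 (the determinant of a unipotent symmetric linear description) -/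

section LinearDescription

variable {R : Type*} [CommRing R] {ι : Type*} [Fintype ι] [DecidableEq ι]

/-- **Quarez 2012, Prop. 2.6 (p0006).** "Assume that the polynomial `q(x)` admits a symmetric
linear unipotent description. Namely, `q(x) = Cᵗ(J - L_A(x))⁻¹C` where `J` is a signature matrix
and `A` is symmetric. Then, we have the identity `1 - q(x) = det(J) det(J - CCᵗ - L_A(x))`."
Typed over any commutative ring with exactly the hypotheses the printed proof uses: an inverse
`G` of `J - L` (so `q = Cᵗ G C`), `det (J - L) = det J` ("since `JA` is nilpotent",
Def. 2.5) and `det J · det J = 1` (a signature matrix, §1 Notations). Proof as printed: the two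
Schur complements (Prop. 2.4 = Mathlib `Matrix.det_fromBlocks₁₁/₂₂`) of the bordered matrix
`G = [[J - L_A, C], [Cᵗ, 1]]`. [cite: Quarez2012, Prop. 2.6] -/
theorem prop_2_6 (J L G : Matrix ι ι R) (C₀ : ι → R) (hG : (J - L) * G = 1)
    (hdet : (J - L).det = J.det) (hJ : J.det * J.det = 1) :
    1 - C₀ ⬝ᵥ (G *ᵥ C₀) = J.det * (J - Matrix.vecMulVec C₀ C₀ - L).det := by
  letI : Invertible (J - L) := invertibleOfRightInverse _ _ hG
  have hinv : ⅟(J - L) = G := invOf_eq_right_inv hG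
  -- the bordered matrix of the printed proof
  set Gm : Matrix (ι ⊕ Unit) (ι ⊕ Unit) R :=
    Matrix.fromBlocks (J - L) (Matrix.replicateCol Unit C₀) (Matrix.replicateRow Unit C₀) 1
    with hGm
  -- Schur complement relative to the entry (1,1)
  have hS : (1 : Matrix Unit Unit R) - Matrix.replicateRow Unit C₀ * ⅟(J - L) *
      Matrix.replicateCol Unit C₀ = Matrix.of fun _ _ => 1 - C₀ ⬝ᵥ (G *ᵥ C₀) := by
    ext ⟨⟩ ⟨⟩
    rw [Matrix.sub_apply, Matrix.one_apply_eq, hinv, ← Matrix.replicateRow_vecMul,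
      Matrix.replicateRow_mul_replicateCol_apply, ← Matrix.dotProduct_mulVec, Matrix.of_apply]
  have h₁ : Gm.det = J.det * (1 - C₀ ⬝ᵥ (G *ᵥ C₀)) := by
    rw [hGm, det_fromBlocks₁₁, hdet, hS]
    congr 1
    rw [det_unique, Matrix.of_apply]
  -- Schur complement relative to the entry (2,2)
  letI : Invertible (1 : Matrix Unit Unit R) := invertibleOne
  have h₂ : Gm.det = (J - Matrix.vecMulVec C₀ C₀ - L).det := by
    rw [hGm, det_fromBlocks₂₂, det_one, one_mul, invOf_one', Matrix.mul_one,
      ← Matrix.vecMulVec_eq Unit, sub_right_comm]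
  rw [← h₂, h₁, ← mul_assoc, hJ, one_mul]

end LinearDescription

/-! ### The printed statement: Theorem 4.1 (1), and corollaries in the tree's vocabulary -/

section Main

variable {R : Type*} [CommRing R] [Invertible (2 : R)]

/-- **Quarez 2012, Theorem 4.1 (1), for any finite set of variables**: over a commutative ring in
which `2` is a unit, a polynomial of total degree `≤ d` in the variables `σ` is the determinant
of a SYMMETRIC `N × N` matrix of affine linear forms with `N = 2·C(|σ| + ⌊d/2⌋, ⌊d/2⌋)`
(tree vocabulary `HasSymmDetRepr`). [cite: Quarez2012, Thm. 4.1 (1)] -/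
theorem hasSymmDetRepr_of_totalDegree_le' {σ : Type*} [Fintype σ] [DecidableEq σ]
    (p : MvPolynomial σ R) {d : ℕ} (hp : p.totalDegree ≤ d) :
    HasSymmDetRepr p (2 * (Fintype.card σ + d / 2).choose (d / 2)) :=
  (hasSymmDetRepr_of_totalDegree_le (e := d / 2) p (hp.trans (by omega))).mono (Nat.sub_le _ _)

/-- **Quarez 2012, Theorem 4.1 (1) (p0014 L12–19), AS PRINTED up to the ring hypothesis.** "Let
`p(x)` be a polynomial of degree `d` in `n` variables over a ring `R` of characteristic different
from `2`. Let `N = 2·C(n + ⌊d/2⌋, n)`. Then, 1) There is a symmetric `N × N` affine linear pencil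
`A₀ + L_A(x)` with entries in `R` such that `p(x) = det(A₀ + L_A(x))`."
TYPED vs PRINTED: "degree `d`" = total degree `≤ d` (padding, `HasSymmDetRepr.mono`);
"characteristic different from `2`" is typed as "`2` is a unit of `R`" — the printed proof uses
`½` (Prop. 3.2: `λ = ½`; p0015: `W⁻¹ = ½ J Wᵗ S_N`), and for `R = ℤ` (characteristic `0`) the
sentence as printed is FALSE, see `thm_4_1_asPrinted_counterexample_int` below.
[cite: Quarez2012, Thm. 4.1 (1)] -/
theorem quarez2012_thm_4_1 {n d : ℕ} (p : MvPolynomial (Fin n) R) (hp : p.totalDegree ≤ d) :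
    HasSymmDetRepr p (2 * (n + d / 2).choose n) := by
  have h := hasSymmDetRepr_of_totalDegree_le' p hp
  rwa [Fintype.card_fin, ← Nat.choose_symm_add] at h

/-- Theorem 4.1 (1) over a field of characteristic `≠ 2` (the tree's GKKP convention
`(2 : k) ≠ 0`). [cite: Quarez2012, Thm. 4.1 (1)] -/
theorem quarez2012_thm_4_1_field (k : Type*) [Field k] (h2 : (2 : k) ≠ 0) {n d : ℕ}
    (p : MvPolynomial (Fin n) k) (hp : p.totalDegree ≤ d) :
    HasSymmDetRepr p (2 * (n + d / 2).choose n) := by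
  letI : Invertible (2 : k) := invertibleOfNonzero h2
  exact quarez2012_thm_4_1 p hp

/-- The sharper size `2·C(n + ⌊d/2⌋, n) - 1` delivered by the folded construction of this file
(one less than printed: the root half-monomial `1` is not doubled).
[cite: Quarez2012, Thm. 4.1 (1)] -/
theorem hasSymmDetRepr_two_mul_choose_sub_one {n d : ℕ} (p : MvPolynomial (Fin n) R)
    (hp : p.totalDegree ≤ d) : HasSymmDetRepr p (2 * (n + d / 2).choose n - 1) := by
  have h := hasSymmDetRepr_of_totalDegree_le (e := d / 2) p (hp.trans (by omega))
  rwa [Fintype.card_fin, ← Nat.choose_symm_add] at h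

/-- **Corollary (tree vocabulary): `sdc(p) ≤ 2·C(n + ⌊d/2⌋, n) - 1 ≤ 2·C(n + ⌊d/2⌋, n)`** for
every `p` of total degree `≤ d` in `n` variables over a commutative ring with `½` — Quarez's
bound on the symmetric determinantal complexity `symmDeterminantalComplexity`.
[cite: Quarez2012, Thm. 4.1 (1)] -/
theorem symmDeterminantalComplexity_le_two_mul_choose {n d : ℕ} (p : MvPolynomial (Fin n) R)
    (hp : p.totalDegree ≤ d) :
    symmDeterminantalComplexity p ≤ 2 * (n + d / 2).choose n - 1 :=
  symmDeterminantalComplexity_le (hasSymmDetRepr_two_mul_choose_sub_one p hp)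

/-- In particular every polynomial over such a ring HAS a symmetric affine determinantal
representation (the HMV theorem [HMV06, Thm. 14.1] over `ℝ`; Quarez's point is the elementary
proof with an explicit size), so `sdc` never takes its junk value here. Over FIELDS with `2 ≠ 0`
the tree already had existence with GKKP's size (`exists_hasSymmDetRepr` of
`GKKP11SymmetricRepresentationsProofs.lean`, `≤ 4·C(n+d-1, n) - 2`).
[cite: Quarez2012, Thm. 4.1 (1); Introduction p0002] -/
theorem exists_hasSymmDetRepr_of_invertible_two {σ : Type*} [Fintype σ] [DecidableEq σ]
    (p : MvPolynomial σ R) : ∃ m, HasSymmDetRepr p m :=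
  ⟨_, hasSymmDetRepr_of_totalDegree_le' p le_rfl⟩

/-- Hence `sdc(p)` is attained: `p` is the determinant of a symmetric matrix of affine forms of
size exactly `symmDeterminantalComplexity p`. [cite: Quarez2012, Thm. 4.1 (1)] -/
theorem hasSymmDetRepr_symmDeterminantalComplexity' {σ : Type*} [Fintype σ] [DecidableEq σ]
    (p : MvPolynomial σ R) : HasSymmDetRepr p (symmDeterminantalComplexity p) :=
  hasSymmDetRepr_symmDeterminantalComplexity (exists_hasSymmDetRepr_of_invertible_two p)

omit [Invertible (2 : R)] in
/-- **Comparison with GKKP 2011, Thm. 7** (`GKKP2011_thm7`: `sdc ≤ 4·C(n+d-1, n) - 2` for total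
degree `≤ d`, `d ≥ 1`): Quarez's bound is never worse, `2·C(n + ⌊d/2⌋, n) ≤ 4·C(n+d-1, n) - 2`
(GKKP §4, p0017: "Quarez's construction is exponentially better in the general case", with the
quotient bound `eⁿ` for degree `2d`; only the elementary domination is typed here).
[cite: GrenetEtAl2011, §4 (comparison with Thm. 7)] -/
theorem two_mul_choose_le_gkkp_thm7_bound (n : ℕ) {d : ℕ} (hd : 1 ≤ d) :
    2 * (n + d / 2).choose n ≤ 4 * (n + d - 1).choose n - 2 := by
  have h1 : (n + d / 2).choose n ≤ (n + d - 1).choose n := Nat.choose_le_choose n (by omega)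
  have h2 : 1 ≤ (n + d - 1).choose n := Nat.choose_pos (by omega)
  omega

end Main

/-! ### Theorem 3.4: the signature form over `ℝ` -/

section Real

variable {σ : Type*}

/-- Entries of a congruence `W M Wᵀ` of a matrix of affine forms by a scalar matrix are affine.
[folklore] -/
private theorem totalDegree_conj_le {R : Type*} [CommRing R] {ι : Type*} [Fintype ι]
    (W : Matrix ι ι R) (M : Matrix ι ι (MvPolynomial σ R)) (hM : ∀ a b, (M a b).totalDegree ≤ 1)
    (i j : ι) : ((W.map C * M * (W.map C)ᵀ : Matrix ι ι (MvPolynomial σ R)) i j).totalDegree ≤ 1 := by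
  rw [Matrix.mul_apply]
  refine (totalDegree_finsetSum _ _).trans (Finset.sup_le fun b _ => ?_)
  rw [Matrix.transpose_apply, Matrix.map_apply, Matrix.mul_apply]
  refine (totalDegree_mul _ _).trans ?_
  rw [totalDegree_C, add_zero]
  refine (totalDegree_finsetSum _ _).trans (Finset.sup_le fun a _ => ?_)
  rw [Matrix.map_apply]
  refine (totalDegree_mul _ _).trans ?_
  rw [totalDegree_C, zero_add]
  exact hM a b

/-- **Quarez 2012, Theorem 3.4 (p0011 L79–83).** "Let `p(x)` be a polynomial of degree `d` in `n`
variables over `ℝ` such that `p(0) ≠ 0`. Then, `p(x)` admits a symmetric determinantal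
representation, namely there are a signature matrix `J ∈ Sℝ^{N×N}`, and a `N × N` symmetric
linear pencil `L_A(x)` such that `p(x) = p(0) det(J) det(J - L_A(x))` where
`N = 2·C(n + ⌊d/2⌋, n)`." Typed: `B = J - L_A(x)` is a symmetric `N × N` matrix of affine linear
forms whose constant part `B(0) = B.map constantCoeff` IS the signature matrix `J = diag(ε)`,
`εᵢ = ±1` (so `L_A = J - B` is a symmetric linear pencil without constant term), and
`p = p(0)·det(J)·det(B)`, `p(0) = constantCoeff p`; "degree `d`" = total degree `≤ d`.
Proof as printed: Thm. 4.1 (1) gives `p = det M`; "since `p(0) ≠ 0`, the matrix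
`J - C̃C̃ᵗ - A_{n+1}`" — here the constant part `M(0)`, `det M(0) = p(0)` — "is symmetric
invertible, so there is another signature matrix `J'` and a symmetric invertible matrix `V` such
that `J - C̃C̃ᵗ - A_{n+1} = V⁻¹J'(V⁻¹)ᵗ`": congruence diagonalisation (tree
`Literature.NumberTheory.QuadraticForms.exists_congr_diagonal`, Serre IV §1.4) normalised to `±1`
by the square roots `√|cᵢ|`; then `p = det(J) det(V)⁻² det(J' - L_{A'}(x))`.
[cite: Quarez2012, Thm. 3.4] -/
theorem quarez2012_thm_3_4 {n d : ℕ} (p : MvPolynomial (Fin n) ℝ) (hp : p.totalDegree ≤ d)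
    (h0 : constantCoeff p ≠ 0) :
    ∃ (ε : Fin (2 * (n + d / 2).choose n) → ℝ)
      (B : Matrix (Fin (2 * (n + d / 2).choose n)) (Fin (2 * (n + d / 2).choose n))
        (MvPolynomial (Fin n) ℝ)),
      (∀ i, ε i = 1 ∨ ε i = -1) ∧ B.IsSymm ∧ (∀ i j, (B i j).totalDegree ≤ 1) ∧
        B.map constantCoeff = Matrix.diagonal ε ∧
        p = C (constantCoeff p * (Matrix.diagonal ε).det) * B.det := by
  letI : Invertible (2 : ℝ) := invertibleOfNonzero two_ne_zero
  obtain ⟨M, hMs, hMd, hMdet⟩ := quarez2012_thm_4_1 p hp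
  -- the constant part `M(0)` and its determinant `p(0)`
  set M₀ : Matrix (Fin (2 * (n + d / 2).choose n)) (Fin (2 * (n + d / 2).choose n)) ℝ :=
    M.map constantCoeff with hM₀
  have hM₀s : M₀.IsSymm := hMs.map _
  have hM₀det : M₀.det = constantCoeff p := by
    rw [hM₀, ← RingHom.mapMatrix_apply, ← RingHom.map_det, hMdet]
  -- congruence diagonalisation over `ℝ`
  obtain ⟨P, Q, c, -, -, hD, hc⟩ :=
    Literature.NumberTheory.QuadraticForms.exists_congr_diagonal M₀ hM₀s
  have hc' : ∀ i, c i ≠ 0 := hc (by rw [hM₀det]; exact h0)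
  -- signs and square roots: `cᵢ = sᵢ εᵢ sᵢ`
  set ε : Fin (2 * (n + d / 2).choose n) → ℝ := fun i => if 0 < c i then 1 else -1 with hε
  set s : Fin (2 * (n + d / 2).choose n) → ℝ := fun i => Real.sqrt |c i| with hs
  have hs0 : ∀ i, s i ≠ 0 := fun i => Real.sqrt_ne_zero'.2 (abs_pos.2 (hc' i))
  have hεsq : ∀ i, ε i * ε i = 1 := fun i => by
    simp only [hε]
    split_ifs <;> norm_num
  have hcs : ∀ i, c i = s i * (ε i * s i) := by
    intro i
    have hss : s i * s i = |c i| := Real.mul_self_sqrt (abs_nonneg _)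
    rw [mul_left_comm, hss, hε]
    dsimp only
    split_ifs with h
    · rw [one_mul, abs_of_pos h]
    · rw [abs_of_neg (lt_of_le_of_ne (not_lt.1 h) (hc' i)), neg_one_mul, neg_neg]
  -- `W M₀ Wᵀ = J` with `W = diag(s⁻¹) Pᵀ`
  set W : Matrix (Fin (2 * (n + d / 2).choose n)) (Fin (2 * (n + d / 2).choose n)) ℝ :=
    Matrix.diagonal (fun i => (s i)⁻¹) * Pᵀ with hW
  have hWJ : W * M₀ * Wᵀ = Matrix.diagonal ε := by
    have h1 : Matrix.diagonal (fun i => (s i)⁻¹) * (Pᵀ * M₀ * P) *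
        Matrix.diagonal (fun i => (s i)⁻¹) = Matrix.diagonal ε := by
      rw [hD, Matrix.diagonal_mul_diagonal, Matrix.diagonal_mul_diagonal]
      congr 1
      funext i
      rw [hcs i, ← mul_assoc, inv_mul_cancel₀ (hs0 i), one_mul, mul_assoc,
        mul_inv_cancel₀ (hs0 i), mul_one]
    rw [← h1, hW, Matrix.transpose_mul, Matrix.transpose_transpose, Matrix.diagonal_transpose]
    simp only [Matrix.mul_assoc]
  have hdetJ : (W.det * M₀.det) * W.det = (Matrix.diagonal ε).det := by
    rw [← Matrix.det_mul, ← Matrix.det_transpose W, ← Matrix.det_mul, hWJ]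
  have hJsq : (Matrix.diagonal ε).det * (Matrix.diagonal ε).det = 1 := by
    rw [Matrix.det_diagonal, ← Finset.prod_mul_distrib]
    exact Finset.prod_eq_one fun i _ => hεsq i
  -- the pencil `B = W(x) M W(x)ᵀ`
  have hWC : (W.map C : Matrix _ _ (MvPolynomial (Fin n) ℝ)).map constantCoeff = W := by
    rw [Matrix.map_map]
    convert Matrix.map_id W
    exact funext fun r => constantCoeff_C _ r
  have hdetWc : (W.map (C : ℝ →+* MvPolynomial (Fin n) ℝ)).det = C W.det := by
    rw [← RingHom.mapMatrix_apply, ← RingHom.map_det]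
  refine ⟨ε, W.map C * M * (W.map C)ᵀ, fun i => ?_, ?_, totalDegree_conj_le W M hMd, ?_, ?_⟩
  · simp only [hε]
    split_ifs
    · exact Or.inl rfl
    · exact Or.inr rfl
  · unfold Matrix.IsSymm
    rw [Matrix.transpose_mul, Matrix.transpose_mul, Matrix.transpose_transpose, hMs.eq,
      Matrix.mul_assoc]
  · rw [Matrix.map_mul, Matrix.map_mul, Matrix.transpose_map, hWC, ← hM₀, hWJ]
  · rw [Matrix.det_mul, Matrix.det_mul, Matrix.det_transpose, hdetWc, hMdet]
    have key : constantCoeff p * (Matrix.diagonal ε).det * (W.det * W.det) = 1 := by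
      rw [← hM₀det, ← hJsq, ← hdetJ]
      ring
    calc p = C (constantCoeff p * (Matrix.diagonal ε).det * (W.det * W.det)) * p := by
          rw [key, C_1, one_mul]
      _ = C (constantCoeff p * (Matrix.diagonal ε).det) * (C W.det * p * C W.det) := by
          simp only [map_mul]
          ring

end Real

/-! ### Theorem 4.1 (2): the signature form over a ring for `p = P + p(0)`, `P` homogeneous odd -/

section RingSignature

variable {R : Type*} [CommRing R] [Invertible (2 : R)] {σ : Type*} [DecidableEq σ] {e : ℕ}

/-- A monomial of degree exactly `2e+1` contributes no constant term to the middle block (its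
letter is a variable). [cite: Quarez2012, Prop. 3.2 (proof)] -/
private theorem constantCoeff_pairE_of_deg {γ : σ →₀ ℕ} (hγ0 : γ ≠ 0)
    (hγ : (γ.sum fun _ k => k) = 2 * e + 1) (a b : Sym (Option σ) e) :
    constantCoeff (pairE R σ e γ a b) = 0 := by
  obtain ⟨i, hi⟩ := Option.ne_none_iff_exists'.1 (split_ne_none (R := R) (e := e) hγ0 hγ)
  unfold pairE
  rw [Matrix.add_apply, Matrix.single_apply, Matrix.single_apply, hi, lett_some]
  split_ifs <;> simp

/-- The constant monomial sits at the root corner with constant term `½ + ½ = 1`. [folklore] -/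
private theorem constantCoeff_pairE_zero (a b : Sym (Option σ) e) :
    constantCoeff (pairE R σ e 0 a b) = if root σ e = a ∧ root σ e = b then 1 else 0 := by
  unfold pairE
  rw [split_zero, Matrix.add_apply, Matrix.single_apply]
  dsimp only
  split_ifs <;> simp [invOf_two_add_invOf_two]

variable [Fintype σ]

/-- `exists_qform_eq` with the constant part recorded: if every non-constant monomial of `q` has
degree exactly `2e + 1` (`q = Q(x) + q(0)`, `Q` homogeneous of odd degree — the setting of
Thm. 4.1 (2)), the middle block may be taken with constant part `q(0)·E_{root,root}`.
[cite: Quarez2012, Thm. 4.1 (2) (proof: "linear descriptions of type `(D₀ S_N D₀)`")] -/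
private theorem exists_qform_eq_cc (q : MvPolynomial σ R) (hq : q.totalDegree ≤ 2 * e + 1)
    (hhom : ∀ γ ∈ q.support, γ ≠ 0 → (γ.sum fun _ k => k) = 2 * e + 1) :
    ∃ Φ : Matrix (Sym (Option σ) e) (Sym (Option σ) e) (MvPolynomial σ R),
      Φ.IsSymm ∧ (∀ a b, (Φ a b).totalDegree ≤ 1) ∧ hvec R σ e ⬝ᵥ (Φ *ᵥ hvec R σ e) = q ∧
        ∀ a b, constantCoeff (Φ a b) =
          if root σ e = a ∧ root σ e = b then constantCoeff q else 0 := by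
  have key : ∀ s : Finset (σ →₀ ℕ), (∀ γ ∈ s, (γ.sum fun _ k => k) ≤ 2 * e + 1) →
      (∀ γ ∈ s, γ ≠ 0 → (γ.sum fun _ k => k) = 2 * e + 1) →
      ∃ Φ : Matrix (Sym (Option σ) e) (Sym (Option σ) e) (MvPolynomial σ R),
        Φ.IsSymm ∧ (∀ a b, (Φ a b).totalDegree ≤ 1) ∧
          hvec R σ e ⬝ᵥ (Φ *ᵥ hvec R σ e) = ∑ γ ∈ s, monomial γ (q.coeff γ) ∧
          ∀ a b, constantCoeff (Φ a b) =
            if root σ e = a ∧ root σ e = b then (if (0 : σ →₀ ℕ) ∈ s then q.coeff 0 else 0)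
            else 0 := by
    intro s
    induction s using Finset.induction_on with
    | empty =>
      intro _ _
      exact ⟨0, Matrix.isSymm_zero, fun a b => by simp, by simp, fun a b => by simp⟩
    | insert γ s hγs ih =>
      intro hs hs'
      obtain ⟨Φ, hΦs, hΦd, hΦq, hΦc⟩ := ih (fun γ' hγ' => hs γ' (Finset.mem_insert_of_mem hγ'))
        (fun γ' hγ' => hs' γ' (Finset.mem_insert_of_mem hγ'))
      refine ⟨q.coeff γ • pairE R σ e γ + Φ, (Matrix.IsSymm.smul (pairE_isSymm γ) _).add hΦs,
        fun a b => ?_, ?_, fun a b => ?_⟩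
      · rw [Matrix.add_apply, Matrix.smul_apply]
        exact (totalDegree_add _ _).trans
          (max_le ((totalDegree_smul_le _ _).trans (totalDegree_pairE_le γ a b)) (hΦd a b))
      · rw [Matrix.add_mulVec, dotProduct_add, Matrix.smul_mulVec, dotProduct_smul, hΦq,
          qform_pairE (hs γ (Finset.mem_insert_self γ s)), smul_monomial, smul_eq_mul, mul_one,
          Finset.sum_insert hγs]
      · rw [Matrix.add_apply, Matrix.smul_apply, map_add, smul_eq_C_mul, map_mul, constantCoeff_C,
          hΦc a b]
        by_cases hγ0 : γ = 0
        · subst hγ0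
          rw [constantCoeff_pairE_zero]
          simp only [Finset.mem_insert, true_or, if_true, hγs, if_false]
          split_ifs <;> ring
        · rw [constantCoeff_pairE_of_deg hγ0 (hs' γ (Finset.mem_insert_self γ s) hγ0), mul_zero,
            zero_add]
          have h0 : ((0 : σ →₀ ℕ) ∈ insert γ s) ↔ (0 : σ →₀ ℕ) ∈ s := by
            simp [Finset.mem_insert, Ne.symm hγ0]
          simp only [h0]
  obtain ⟨Φ, h1, h2, h3, h4⟩ := key q.support (fun γ hγ => (le_totalDegree hγ).trans hq) hhom
  refine ⟨Φ, h1, h2, h3.trans q.as_sum.symm, fun a b => ?_⟩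
  rw [h4 a b, constantCoeff_eq]
  by_cases h0 : (0 : σ →₀ ℕ) ∈ q.support
  · rw [if_pos h0]
  · rw [if_neg h0, notMem_support_iff.1 h0]

omit [Invertible (2 : R)] [DecidableEq σ] [Fintype σ] in
/-- `map` by a ring homomorphism commutes with the bordered construction. [folklore] -/
private theorem bordered_map {J : Type*} [DecidableEq J] {S : Type*} [CommRing S] (f : R →+* S)
    (Φ₀ : R) (φ : J → R) (Φ' N : Matrix J J R) (c : J → R) :
    (bordered Φ₀ φ Φ' N c).map f = bordered (f Φ₀) (f ∘ φ) (Φ'.map f) (N.map f) (f ∘ c) := by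
  ext (u | a | a) (u' | b | b) <;>
    simp [bordered, borderRow, midBlock', Matrix.one_apply, apply_ite f]

omit [Invertible (2 : R)] [DecidableEq σ] [Fintype σ] in
/-- The constant part of the bordered matrix in the homogeneous-odd case is
`[[w, 0, 0], [0, 0, 1], [0, 1, 0]]`. [folklore] -/
private theorem bordered_const {J : Type*} [DecidableEq J] (w : R) :
    bordered w (0 : J → R) (0 : Matrix J J R) 0 0 =
      Matrix.fromBlocks (Matrix.of fun _ _ => w) 0 0
        (Matrix.fromBlocks 0 1 1 0 : Matrix (J ⊕ J) (J ⊕ J) R) := by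
  ext (u | a | a) (u' | b | b) <;> simp [bordered, borderRow, midBlock']

variable (R) in
/-- Quarez's `R`-rational congruence `V = [[½, 1], [½, -1]] ⊗ I` (p0014: "In order to work over
`R`, we will prefer to write `[[1,1],[1,-1]] [[1,0],[0,-1]] [[1,1],[1,-1]] = 2·[[0,1],[1,0]]`").
[cite: Quarez2012, Thm. 4.1 (proof, p0014)] -/
def swapCongr (J : Type*) [DecidableEq J] : Matrix (J ⊕ J) (J ⊕ J) R :=
  Matrix.fromBlocks ((⅟2 : R) • (1 : Matrix J J R)) (1 : Matrix J J R)
    ((⅟2 : R) • (1 : Matrix J J R)) (-1 : Matrix J J R)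

omit [DecidableEq σ] [Fintype σ] in
/-- The congruence `V = [[½, 1], [½, -1]] ⊗ I` takes `[[0, I], [I, 0]]` to the signature matrix
`[[I, 0], [0, -I]]`. [cite: Quarez2012, Thm. 4.1 (proof, p0014)] -/
private theorem congr_swap_blocks {J : Type*} [Fintype J] [DecidableEq J] :
    swapCongr R J * Matrix.fromBlocks 0 (1 : Matrix J J R) (1 : Matrix J J R) 0 * (swapCongr R J)ᵀ =
      Matrix.fromBlocks (1 : Matrix J J R) 0 0 (-1 : Matrix J J R) := by
  rw [swapCongr, Matrix.fromBlocks_transpose, Matrix.fromBlocks_multiply,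
    Matrix.fromBlocks_multiply]
  simp only [Matrix.transpose_one, Matrix.transpose_neg, Matrix.transpose_smul, Matrix.mul_zero,
    Matrix.mul_one, zero_add, add_zero, Matrix.mul_smul, Matrix.mul_neg, smul_neg]
  rw [← add_smul, invOf_two_add_invOf_two, one_smul, add_neg_cancel, neg_add_cancel, ← neg_add,
    ← add_smul, invOf_two_add_invOf_two, one_smul]

omit [DecidableEq σ] [Fintype σ] in
/-- and has determinant `(-1)^{|J|}` (in particular a unit whose square is `1`). [folklore] -/
private theorem det_congr_swap_blocks {J : Type*} [Fintype J] [DecidableEq J] :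
    (swapCongr R J).det = (-1) ^ Fintype.card J := by
  rw [swapCongr, Literature.LinearAlgebra.Matrix.det_fromBlocks_of_commute₂₂₂₁ _ _ _ _
    (by rw [Matrix.mul_smul, Matrix.smul_mul, Matrix.mul_one, Matrix.one_mul]),
    Matrix.smul_mul, Matrix.one_mul, Matrix.one_mul, smul_neg, ← neg_add', ← add_smul,
    invOf_two_add_invOf_two, one_smul, Matrix.det_neg, Matrix.det_one, mul_one]

/-- **Quarez 2012, Theorem 4.1 (2) (p0014 L17–19), any finite set of variables.** "If
`p(x) = P(x) + p(0)` where `P(x)` is a homogeneous polynomial of odd degree and `p(0)` is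
invertible in `R`, then there is a symmetric determinantal representation as in Theorem 3.4.
Namely, there are a signature matrix `J ∈ SR^{N×N}`, and a `N × N` symmetric linear pencil
`L_A(x)` with coefficients in `R` such that `p(x) = p(0) det(J) det(J - L_A(x))`"
(`N = 2·C(n + ⌊d/2⌋, n)`, `d = 2e + 1`). Typed as in `quarez2012_thm_3_4` (`B = J - L_A(x)`
symmetric affine with constant part `diag(ε)`, `εᵢ = ±1`), over a commutative ring with `½`,
`p(0)` a unit (witnessed by `v`, `p(0)·v = 1`), `N = 2·C(|σ|+e, e)`; the `Fin n` form is
`quarez2012_thm_4_1_2`. Proof: for such `p` the middle block has constant part `±E_{root,root}`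
(`exists_qform_eq_cc`), so the constant part of the bordered matrix is
`[[±1, 0, 0], [0, 0, I], [0, I, 0]]`, congruent over `R` by Quarez's `[[1,1],[1,-1]]`-trick
(`swapCongr`, determinant `±1`) to a signature matrix; pad by `(1)` to the printed even size.
[cite: Quarez2012, Thm. 4.1 (2)] -/
theorem exists_signature_form_of_isHomogeneous (p : MvPolynomial σ R)
    (hP : (p - C (constantCoeff p)).IsHomogeneous (2 * e + 1)) (v : R)
    (hv : constantCoeff p * v = 1) {N : ℕ} (hN : 2 * (Fintype.card σ + e).choose e = N) :
    ∃ (ε : Fin N → R) (B : Matrix (Fin N) (Fin N) (MvPolynomial σ R)),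
      (∀ i, ε i = 1 ∨ ε i = -1) ∧ B.IsSymm ∧ (∀ i j, (B i j).totalDegree ≤ 1) ∧
        B.map constantCoeff = Matrix.diagonal ε ∧
        p = C (constantCoeff p * (Matrix.diagonal ε).det) * B.det := by
  set m := Fintype.card (NonRoot σ e) with hm
  set sgn : R := (-1) ^ m with hsgn
  have hsgn2 : sgn * sgn = 1 := by rw [hsgn, ← pow_add, ← two_mul, pow_mul, neg_one_sq, one_pow]
  -- degree bookkeeping
  have hp : p.totalDegree ≤ 2 * e + 1 := by
    have : p = (p - C (constantCoeff p)) + C (constantCoeff p) := by ring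
    rw [this]
    exact (totalDegree_add _ _).trans (max_le hP.totalDegree_le (by simp))
  set q : MvPolynomial σ R := sgn • (v • p) with hq
  have hqdeg : q.totalDegree ≤ 2 * e + 1 :=
    (totalDegree_smul_le _ _).trans ((totalDegree_smul_le _ _).trans hp)
  have hq0 : constantCoeff q = sgn := by
    rw [hq, smul_eq_C_mul, smul_eq_C_mul, map_mul, map_mul, constantCoeff_C, constantCoeff_C,
      mul_comm v, hv, mul_one]
  have hhom : ∀ γ ∈ q.support, γ ≠ 0 → (γ.sum fun _ k => k) = 2 * e + 1 := by
    intro γ hγ hγ0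
    have hγp : γ ∈ p.support := support_smul (support_smul hγ)
    by_contra hne
    have hz : coeff γ (p - C (constantCoeff p)) = 0 :=
      hP.coeff_eq_zero (by rw [Finsupp.degree_apply]; exact hne)
    rw [coeff_sub, coeff_C, if_neg (Ne.symm hγ0), sub_zero] at hz
    exact (mem_support_iff.1 hγp) hz
  obtain ⟨Φ, hΦs, hΦd, hΦq, hΦc⟩ := exists_qform_eq_cc (e := e) q hqdeg hhom
  -- the bordered matrix `M` with `det M = v • p` and its constant part
  set M := bordered (Φ (root σ e) (root σ e)) (fun β : NonRoot σ e => Φ (root σ e) β.1)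
    (Φ.submatrix Subtype.val Subtype.val) (predN R σ e) (rootCol R σ e) with hM
  have hMs : M.IsSymm := isSymm_bordered _ _ (hΦs.submatrix _) _ _
  have hMd : ∀ a b, (M a b).totalDegree ≤ 1 := by
    have h1N : ∀ a b : NonRoot σ e, ((1 + predN R σ e) a b).totalDegree ≤ 1 := by
      intro a b
      rw [Matrix.add_apply, Matrix.one_apply, predN, Matrix.of_apply]
      refine (totalDegree_add _ _).trans (max_le ?_ ?_) <;> split_ifs <;>
        simp [totalDegree_neg, (totalDegree_lett_le (R := R) (some (var a))).trans']
    have hc : ∀ b : NonRoot σ e, (rootCol R σ e b).totalDegree ≤ 1 := by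
      intro b
      rw [rootCol]
      split_ifs
      · exact totalDegree_lett_le (R := R) (some (var b))
      · simp
    rintro (u | a | a) (u' | b | b)
    · exact hΦd _ _
    · exact hΦd _ _
    · simpa [hM, bordered, borderRow, totalDegree_neg] using hc b
    · exact hΦd _ _
    · exact hΦd _ _
    · change (((1 + predN R σ e)ᵀ) a b).totalDegree ≤ 1
      rw [transpose_apply]
      exact h1N b a
    · simpa [hM, bordered, borderRow, totalDegree_neg] using hc a
    · simpa [hM, bordered, midBlock'] using h1N a b
    · simp [hM, bordered, midBlock']
  have hMdet : M.det = v • p := by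
    rw [hM, det_bordered _ _ _ _ (GKKP2011.geomInv (predN R σ e) (e + 1)) _ (hvec' R σ e)
      one_add_predN_mul_geomInv det_one_add_predN one_add_predN_mulVec_hvec',
      ← qform_eq_root_add Φ hΦs, hΦq, hq, ← hm, hsgn, smul_eq_C_mul (v • p) ((-1 : R) ^ m),
      map_pow, map_neg, map_one, ← mul_assoc, ← pow_add, ← two_mul, pow_mul, neg_one_sq, one_pow,
      one_mul]
  have hM0 : M.map constantCoeff =
      Matrix.fromBlocks (Matrix.of fun _ _ => sgn) 0 0
        (Matrix.fromBlocks 0 1 1 0 : Matrix (NonRoot σ e ⊕ NonRoot σ e) (NonRoot σ e ⊕ NonRoot σ e) R) := by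
    rw [hM, bordered_map, ← bordered_const]
    have h1 : constantCoeff (Φ (root σ e) (root σ e)) = sgn := by rw [hΦc, if_pos ⟨rfl, rfl⟩, hq0]
    have h2 : (constantCoeff ∘ fun β : NonRoot σ e => Φ (root σ e) β.1) = 0 := by
      funext β
      rw [Function.comp_apply, hΦc, if_neg (fun h => β.2 h.2.symm), Pi.zero_apply]
    have h3 : (Φ.submatrix Subtype.val Subtype.val).map constantCoeff =
        (0 : Matrix (NonRoot σ e) (NonRoot σ e) R) := by
      ext a b
      rw [Matrix.map_apply, Matrix.submatrix_apply, hΦc, if_neg (fun h => a.2 h.1.symm),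
        Matrix.zero_apply]
    have h4 : (predN R σ e).map constantCoeff = 0 := by
      ext a b
      simp only [Matrix.map_apply, predN, Matrix.of_apply, Matrix.zero_apply]
      split_ifs <;> simp
    have h5 : (constantCoeff ∘ rootCol R σ e) = 0 := by
      funext b
      simp only [Function.comp_apply, rootCol, Pi.zero_apply]
      split_ifs <;> simp
    rw [h1, h2, h3, h4, h5]
  -- the congruence to a signature matrix
  set G : Matrix (Unit ⊕ (NonRoot σ e ⊕ NonRoot σ e)) (Unit ⊕ (NonRoot σ e ⊕ NonRoot σ e)) R :=
    Matrix.fromBlocks 1 0 0 (swapCongr R (NonRoot σ e)) with hG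
  have hGdet2 : G.det * G.det = 1 := by
    rw [hG, Matrix.det_fromBlocks_zero₂₁, Matrix.det_one, one_mul, det_congr_swap_blocks,
      ← pow_add, ← two_mul, pow_mul, neg_one_sq, one_pow]
  set εJ : Unit ⊕ (NonRoot σ e ⊕ NonRoot σ e) → R :=
    Sum.elim (fun _ => sgn) (Sum.elim (fun _ => 1) (fun _ => -1)) with hεJ
  have hGJ : G * M.map constantCoeff * Gᵀ = Matrix.diagonal εJ := by
    rw [hM0, hG, Matrix.fromBlocks_transpose, Matrix.fromBlocks_multiply,
      Matrix.fromBlocks_multiply]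
    simp only [Matrix.mul_zero, Matrix.zero_mul, add_zero, zero_add, Matrix.one_mul,
      Matrix.transpose_one, Matrix.mul_one, Matrix.transpose_zero, congr_swap_blocks]
    have hd1 : (Matrix.diagonal fun _ : NonRoot σ e => (-1 : R)) = -1 := by
      rw [← Matrix.diagonal_one, Matrix.diagonal_neg]
    have hd0 : (Matrix.of fun (_ : Unit) (_ : Unit) => sgn) = Matrix.diagonal fun _ => sgn := by
      ext u u'
      rw [Matrix.of_apply, Matrix.diagonal_apply, if_pos (Subsingleton.elim u u')]
    rw [hεJ, ← Matrix.fromBlocks_diagonal, ← Matrix.fromBlocks_diagonal, Matrix.diagonal_one, hd1,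
      ← hd0]
  have hdetJ : (Matrix.diagonal εJ).det = 1 := by
    rw [Matrix.det_diagonal, Fintype.prod_sum_type, Fintype.prod_sum_type]
    simp only [hεJ, Sum.elim_inl, Sum.elim_inr, Finset.prod_const, Finset.card_univ,
      Fintype.card_unit, pow_one, one_pow, one_mul]
    rw [← hm, ← hsgn, hsgn2]
  -- the pencil `B = G(x) M G(x)ᵀ`, padded by a `1 × 1` block `(1)`
  have hGC : (G.map C : Matrix _ _ (MvPolynomial σ R)).map constantCoeff = G := by
    rw [Matrix.map_map]
    convert Matrix.map_id G
    exact funext fun r => constantCoeff_C _ r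
  have hdetGc : (G.map (C : R →+* MvPolynomial σ R)).det = C G.det := by
    rw [← RingHom.mapMatrix_apply, ← RingHom.map_det]
  set B : Matrix (Unit ⊕ (NonRoot σ e ⊕ NonRoot σ e)) (Unit ⊕ (NonRoot σ e ⊕ NonRoot σ e))
    (MvPolynomial σ R) := G.map C * M * (G.map C)ᵀ with hB
  have hBs : B.IsSymm := by
    rw [hB, Matrix.IsSymm, Matrix.transpose_mul, Matrix.transpose_mul, Matrix.transpose_transpose,
      hMs.eq, Matrix.mul_assoc]
  have hBcc : B.map constantCoeff = Matrix.diagonal εJ := by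
    rw [hB, Matrix.map_mul, Matrix.map_mul, Matrix.transpose_map, hGC, hGJ]
  have hBdet : B.det = C (G.det * G.det) * (v • p) := by
    rw [hB, Matrix.det_mul, Matrix.det_mul, Matrix.det_transpose, hdetGc, hMdet, map_mul]
    ring
  -- padding and reindexing to `Fin N`
  letI : DecidableEq ((Unit ⊕ (NonRoot σ e ⊕ NonRoot σ e)) ⊕ Unit) := instDecidableEqSum
  set ε' : (Unit ⊕ (NonRoot σ e ⊕ NonRoot σ e)) ⊕ Unit → R := Sum.elim εJ (fun _ => 1) with hε'
  set B' : Matrix ((Unit ⊕ (NonRoot σ e ⊕ NonRoot σ e)) ⊕ Unit)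
      ((Unit ⊕ (NonRoot σ e ⊕ NonRoot σ e)) ⊕ Unit) (MvPolynomial σ R) :=
    Matrix.fromBlocks B 0 0 1 with hB'
  have hB's : B'.IsSymm := Matrix.IsSymm.fromBlocks hBs (by simp) Matrix.isSymm_one
  have hB'd : ∀ i j, (B' i j).totalDegree ≤ 1 := by
    rintro (i | u) (j | u')
    · simpa [hB', hB] using totalDegree_conj_le G M hMd i j
    · simp [hB']
    · simp [hB']
    · simp only [hB', Matrix.fromBlocks_apply₂₂, Matrix.one_apply]
      split_ifs <;> simp
  have hB'cc : B'.map constantCoeff = Matrix.diagonal ε' := by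
    rw [hε', ← Matrix.fromBlocks_diagonal, hB', Matrix.fromBlocks_map, hBcc, Matrix.diagonal_one]
    congr 1
    simp
  have hdet' : (Matrix.diagonal ε').det = 1 := by
    rw [hε', ← Matrix.fromBlocks_diagonal, Matrix.det_fromBlocks_zero₂₁, hdetJ, one_mul,
      Matrix.det_diagonal]
    simp
  have hB'det : B'.det = C (G.det * G.det) * (v • p) := by
    rw [hB', Matrix.det_fromBlocks_zero₂₁, Matrix.det_one, mul_one, hBdet]
  have hcard : Fintype.card ((Unit ⊕ (NonRoot σ e ⊕ NonRoot σ e)) ⊕ Unit) = N := by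
    have hpos : 1 ≤ (Fintype.card σ + e).choose e := Nat.choose_pos (Nat.le_add_left e _)
    rw [Fintype.card_sum, Fintype.card_sum, Fintype.card_sum, Fintype.card_unit, card_nonRoot, ← hN]
    omega
  set eI := (Fintype.equivFin _).trans (finCongr hcard) with heI
  refine ⟨ε' ∘ eI.symm, Matrix.reindex eI eI B', ?_, hB's.submatrix _, fun i j => ?_, ?_, ?_⟩
  · intro i
    rw [Function.comp_apply]
    generalize eI.symm i = x
    rcases x with ((u | a | a) | u)
    · simpa [hε', hεJ, hsgn] using neg_one_pow_eq_or R m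
    · exact Or.inl (by simp [hε', hεJ])
    · exact Or.inr (by simp [hε', hεJ])
    · exact Or.inl (by simp [hε'])
  · simpa only [Matrix.reindex_apply, Matrix.submatrix_apply] using hB'd _ _
  · rw [Matrix.reindex_apply, ← Matrix.submatrix_map, hB'cc, Matrix.submatrix_diagonal_equiv]
  · rw [Matrix.det_reindex_self, ← Matrix.submatrix_diagonal_equiv, Matrix.det_submatrix_equiv_self,
      hdet', mul_one, hB'det, smul_eq_C_mul, ← mul_assoc, ← mul_assoc, ← map_mul, ← map_mul,
      show constantCoeff p * (G.det * G.det) * v = 1 by rw [hGdet2, mul_one, hv], C_1, one_mul]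

/-- **Quarez 2012, Theorem 4.1 (2), `n` variables, `N = 2·C(n + e, n)` as printed**
(`= 2·C(n + ⌊d/2⌋, n)` for `d = 2e + 1`). [cite: Quarez2012, Thm. 4.1 (2)] -/
theorem quarez2012_thm_4_1_2 {n e : ℕ} (p : MvPolynomial (Fin n) R)
    (hP : (p - C (constantCoeff p)).IsHomogeneous (2 * e + 1)) (v : R)
    (hv : constantCoeff p * v = 1) :
    ∃ (ε : Fin (2 * (n + e).choose n) → R)
      (B : Matrix (Fin (2 * (n + e).choose n)) (Fin (2 * (n + e).choose n)) (MvPolynomial (Fin n) R)),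
      (∀ i, ε i = 1 ∨ ε i = -1) ∧ B.IsSymm ∧ (∀ i j, (B i j).totalDegree ≤ 1) ∧
        B.map constantCoeff = Matrix.diagonal ε ∧
        p = C (constantCoeff p * (Matrix.diagonal ε).det) * B.det :=
  exists_signature_form_of_isHomogeneous p hP v hv
    (by rw [Fintype.card_fin, ← Nat.choose_symm_add])

end RingSignature

/-! ### The ring hypothesis: Theorem 4.1 as printed fails over `ℤ` -/

section IntErratum

variable {R : Type*} [CommRing R] {σ : Type*}

/-- **Base change.** A symmetric affine determinantal representation of `p` over `R` maps, along
any ring map `f : R → S` (entrywise `MvPolynomial.map f`), to one of `map f p` over `S` of the same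
size: symmetry is preserved, total degrees do not go up, `det` commutes with ring maps. (API of the
tree's `HasSymmDetRepr`, GKKP 2011 §1.1 "symmetric matrices with entries variables or field
elements"; used below with `ℤ → ℤ/2`.) [cite: GrenetEtAl2011, §1.1] -/
theorem _root_.Literature.Computability.AlgebraicComplexity.HasSymmDetRepr.map
    {S : Type*} [CommRing S] (f : R →+* S) {p : MvPolynomial σ R}
    {m : ℕ} (h : HasSymmDetRepr p m) : HasSymmDetRepr (MvPolynomial.map f p) m := by
  obtain ⟨A, hAs, hAd, hAdet⟩ := h
  refine ⟨A.map (MvPolynomial.map f), hAs.map _, fun i j => ?_, ?_⟩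
  · rw [Matrix.map_apply]
    exact (Finset.sup_mono (support_map_subset f (A i j))).trans (hAd i j)
  · rw [← hAdet, RingHom.map_det, RingHom.mapMatrix_apply]

/-- Over `ℤ` the polynomial `x₀x₁ + x₂` has NO symmetric affine determinantal representation of any
size: reduce modulo `2` and apply Grenet–Monteil–Thomassé 2013 §4.2 (tree
`GMT2013.not_hasSymmDetRepr_X_mul_X_add_X`, every field of characteristic `2`).
[cite: GrenetMonteilThomasse2013, §4.2] -/
theorem not_hasSymmDetRepr_int_X_mul_X_add_X (N : ℕ) :
    ¬ HasSymmDetRepr (X 0 * X 1 + X 2 : MvPolynomial (Fin 3) ℤ) N := by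
  intro h
  have h2 := h.map (Int.castRingHom (ZMod 2))
  simp only [map_add, map_mul, map_X] at h2
  exact Literature.Barriers.ValiantsHypothesis.GMT2013.not_hasSymmDetRepr_X_mul_X_add_X
    (F := ZMod 2) N h2

/-- **Typed-vs-printed record for Thm. 4.1.** As printed ("over a ring `R` of characteristic
different from `2`") Theorem 4.1 (1) is false: `ℤ` has characteristic `0 ≠ 2`, `x₀x₁ + x₂` has
degree `2`, and it is the determinant of no symmetric affine pencil over `ℤ` of any size (the
printed `N` would be `2·C(3+1, 3) = 8`). The proof in print uses `½ ∈ R`; with "`2 ∈ Rˣ`" it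
holds (`quarez2012_thm_4_1`). [cite: Quarez2012, Thm. 4.1 (1)] -/
theorem thm_4_1_asPrinted_counterexample_int :
    ringChar ℤ ≠ 2 ∧ (X 0 * X 1 + X 2 : MvPolynomial (Fin 3) ℤ).totalDegree ≤ 2 ∧
      ∀ N, ¬ HasSymmDetRepr (X 0 * X 1 + X 2 : MvPolynomial (Fin 3) ℤ) N := by
  refine ⟨by rw [ringChar.eq ℤ 0]; decide, ?_, not_hasSymmDetRepr_int_X_mul_X_add_X⟩
  refine (totalDegree_add _ _).trans (max_le ((totalDegree_mul _ _).trans ?_) ?_) <;>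
    simp [totalDegree_X]

end IntErratum

end Quarez2012

end Literature.Computability.AlgebraicComplexity

end
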